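import Literature.AlgebraicGeometry.ModuliOfAbelianVarieties.SiegelHeckeKernelIndexSet
import Literature.AlgebraicGeometry.ModuliOfAbelianVarieties.HeckeDatumCoprime
import Literature.LinearAlgebra.FreeModule.IntegerMatrixKernelModCard
import HarnessLib

/-!
# The Hecke kernel has order `ν^g`: `#ker(γ̄ · R′ mod M) = |det γ| = ν^g` for an integral similitude datum of multiplier `ν`

Layer `Literature/AlgebraicGeometry/ModuliOfAbelianVarieties`, namespace
`Literature.AlgebraicGeometry.ModuliOfAbelianVarieties`.  THEOREMS ONLY (no definition, no named fact, no instance).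
Cell hodgecm-mathlib (D-0151), Hecke-link socket (QT), brick (DET) of seat B-p15 (g10): the KERNEL COUNT of the Hecke
isogeny quotient `A′ → A′/K`, `K = {φ′(c) : (γ̄ R′) c = 0}` (the exact-kernel clause (ii) of ★
`socketQuotientMaps_of_quotientTriples` / the `hkerF` binder of ★ `exists_level_symplectic_of_heckeQuotient_residue`).

For the integral Hecke datum `(γ, γ⋆)` of ★ `QuotientAdapted.exists_intDatum` — `γ γ⋆ = ν·1`, `ᵗγ⋆ E_δ γ⋆ = ν E_δ` — one
has `(det γ⋆)² = ν^{2g}` (★ `det_sq_eq_pow_of_similitude`) and `det γ · det γ⋆ = ν^{2g}`, hence **`|det γ| = ν^g`**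
([ShimuraIATAF1971] §3.2 «det β = b»); and since `γ ((M/ν)γ⋆) = M·1` for `ν ∣ M`, the kernel of `γ̄ = γ mod M` on `(ℤ/M)^{2g}`
has order `|det γ|` (★ `natCard_ker_mulVec_zmod_eq_natAbs_det`: `M ℤ^{2g} ⊆ γ ℤ^{2g}` ⇒ `#ker γ̄ = #coker γ̄ = [ℤ^{2g} : γ ℤ^{2g}]`),
unchanged by the unit `R′ = r′ mod M` (`r′ ∈ K_δ(1) = GSp_δ(ẑ)`, ★ `exists_similitudeTower`):

* `natAbs_det_eq_pow_of_heckeDatum` — **`|det γ| = ν^g`**;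
* `natCard_heckeKernel_eq_pow` — **`#{c ∈ (ℤ/M)^{2g} : (γ̄ R′) c = 0} = ν^g`** for `ν ∣ M` and `R′` with entries the
  residues of `r′ ∈ K_δ(1)`;
* `natCard_heckeKernel_of_eq_pow` — the same with `R′` spelled inline as
  `Matrix.of (fun i j => integralAdeleResidue M ⟨r′ᵢⱼ, _⟩)` (the (QT)/(ii) socket text verbatim).

This is the input `|K| = ν^g` of the degree count `|ker ψ_s| · |ker ψ^∨_s| = ν^{2g}` of the descended polarisation's type
(★ `Polarization.hasType_of_fibreIsogeny_of_dualIsogeny_of_coprime`, `hker`) and of `|K| · |K′| = ν^{2g}` for the dual-side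
subgroup ([Milne2005ShimuraVarieties] §6 Thm. 6.11: the Hecke operator of a similitude of multiplier `ν` is an isogeny of
degree `ν^g`).

## References

* [ShimuraIATAF1971] G. Shimura, *Introduction to the Arithmetic Theory of Automorphic Functions* (1971), §3.2.
* [Milne2005ShimuraVarieties] J. S. Milne, *Introduction to Shimura Varieties* (2005), §6 Thm. 6.11 pp. 74–75.
* [Deligne1971TravauxShimura] P. Deligne, *Travaux de Shimura*, Sém. Bourbaki 389 (1971), 4.11–4.12 pp. 148–149.
-/

noncomputable section

open Matrix NumberField IsDedekindDomain
open Literature.NumberTheory.Adeles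
open Literature.LinearAlgebra.FreeModule

namespace Literature.AlgebraicGeometry.ModuliOfAbelianVarieties

variable {g : ℕ} {δ : Fin g → ℕ}

/-! ### §1 The determinant of an integral similitude datum -/

/-- **`|det γ| = ν^g`** for an integral Hecke datum `γ γ⋆ = ν·1`, `ᵗγ⋆ E_δ γ⋆ = ν E_δ` (`δᵢ ≠ 0`, `ν ≠ 0`):
`(det γ⋆)² = ν^{2g} = det γ · det γ⋆`, so `det γ = det γ⋆ = ± ν^g`. [cite: ShimuraIATAF1971, §3.2 («det β = b»)]
[cite: Deligne1971TravauxShimura, 4.11–4.12 pp. 148–149] -/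
theorem natAbs_det_eq_pow_of_heckeDatum (hδ : ∀ i, δ i ≠ 0) {ν : ℕ} (hν : ν ≠ 0)
    (γm γs : Matrix (Fin g ⊕ Fin g) (Fin g ⊕ Fin g) ℤ) (hγ : γm * γs = (ν : ℤ) • (1 : Matrix _ _ ℤ))
    (hsim : γsᵀ * typeForm δ * γs = (ν : ℤ) • typeForm δ) :
    γm.det.natAbs = ν ^ g := by
  have hb2 : γs.det ^ 2 = (ν : ℤ) ^ (g + g) := det_sq_eq_pow_of_similitude hδ γs hsim
  have hab : γm.det * γs.det = (ν : ℤ) ^ (g + g) := by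
    have h := congrArg Matrix.det hγ
    rwa [Matrix.det_mul, Matrix.det_smul, Matrix.det_one, mul_one, Fintype.card_sum, Fintype.card_fin] at h
  have hb0 : γs.det ≠ 0 := by
    intro h0
    rw [h0, sq, zero_mul] at hb2
    exact pow_ne_zero _ (by exact_mod_cast hν : (ν : ℤ) ≠ 0) hb2.symm
  have hab' : γm.det = γs.det := by
    rw [← hb2, sq] at hab
    exact mul_right_cancel₀ hb0 hab
  have ha2 : γm.det ^ 2 = ((ν : ℤ) ^ g) ^ 2 := by rw [hab', hb2, ← pow_mul, ← two_mul, mul_comm, pow_mul]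
  rw [Int.natAbs_eq_iff_sq_eq.2 ha2, Int.natAbs_pow, Int.natAbs_natCast]

/-! ### §2 The kernel count -/

/-- **The Hecke kernel has order `ν^g`**: for the integral datum `γ γ⋆ = ν·1`, `ᵗγ⋆ E_δ γ⋆ = ν E_δ`, a level `M` with
`ν ∣ M`, and `R′ ∈ M_{2g}(ℤ/M)` the residue of a principal representative `r′ ∈ K_δ(1)` (a unit, ★ `exists_similitudeTower`),
`#{c ∈ (ℤ/M)^{2g} : (γ̄ R′) c = 0} = |det γ| = ν^g`. [cite: ShimuraIATAF1971, §3.2 («det β = b»)]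
[cite: Milne2005ShimuraVarieties, §6 Thm. 6.11 pp. 74–75] -/
theorem natCard_heckeKernel_eq_pow {M : ℕ} [NeZero M] (hδ : IsPolarizationType δ) (hg : 0 < g) {ν : ℕ} (hν : ν ≠ 0)
    (γm γs : Matrix (Fin g ⊕ Fin g) (Fin g ⊕ Fin g) ℤ) (hγ : γm * γs = (ν : ℤ) • (1 : Matrix _ _ ℤ))
    (hsim : γsᵀ * typeForm δ * γs = (ν : ℤ) • typeForm δ) (hM : ν ∣ M)
    {r' : gspFinAdelic δ} (hr' : r' ∈ principalLevelSubgroup δ 1)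
    (R' : Matrix (Fin g ⊕ Fin g) (Fin g ⊕ Fin g) (ZMod M))
    (hR' : ∀ (i j : Fin g ⊕ Fin g)
      (h : ((r' : GL (Fin g ⊕ Fin g) finAdeleQ) : Matrix (Fin g ⊕ Fin g) (Fin g ⊕ Fin g) finAdeleQ) i j ∈
        FiniteAdeleRing.integralAdeles (𝓞 ℚ) ℚ), R' i j = integralAdeleResidue M ⟨_, h⟩) :
    Nat.card {c : Fin g ⊕ Fin g → ZMod M | (γm.map (Int.castRingHom (ZMod M)) * R') *ᵥ c = 0} = ν ^ g := by
  classical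
  -- `R′` is a unit: it is the level-`M` stage of the similitude tower of `r′`
  obtain ⟨Γ, -, hres, -, -, -⟩ := exists_similitudeTower δ hδ hg hr'
  have hRΓ : R' = ((Γ M : GL (Fin g ⊕ Fin g) (ZMod M)) : Matrix (Fin g ⊕ Fin g) (Fin g ⊕ Fin g) (ZMod M)) := by
    ext i j
    have hint := entries_mem_integralAdeles_of_mem_principalLevelSubgroup_one hr' i j
    rw [hR' i j hint, hres M i j hint]
  have hRu : IsUnit R' := by rw [hRΓ]; exact Units.isUnit _
  -- `γ ((M/ν) γ⋆) = M·1`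
  obtain ⟨k, hk⟩ := hM
  have hAB : γm * ((k : ℤ) • γs) = (M : ℤ) • (1 : Matrix _ _ ℤ) := by
    rw [Matrix.mul_smul, hγ, smul_smul, hk, Nat.cast_mul, mul_comm (k : ℤ)]
  -- count
  have hcount := natCard_ker_mulVec_mul_zmod_eq_natAbs_det γm ((k : ℤ) • γs) hAB hRu
  rw [natAbs_det_eq_pow_of_heckeDatum (fun i => (hδ.1 i).ne') hν γm γs hγ hsim] at hcount
  exact hcount

/-- **The Hecke kernel has order `ν^g`, socket spelling**: the same count with `R′` written inline as the matrix of
residues `Matrix.of (fun i j => integralAdeleResidue M ⟨r′ᵢⱼ, _⟩)` — the set of the exact-kernel clause (ii) of the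
quotient-triples socket verbatim. [cite: ShimuraIATAF1971, §3.2 («det β = b»)]
[cite: Milne2005ShimuraVarieties, §6 Thm. 6.11 pp. 74–75] -/
theorem natCard_heckeKernel_of_eq_pow {M : ℕ} [NeZero M] (hδ : IsPolarizationType δ) (hg : 0 < g) {ν : ℕ} (hν : ν ≠ 0)
    (γm γs : Matrix (Fin g ⊕ Fin g) (Fin g ⊕ Fin g) ℤ) (hγ : γm * γs = (ν : ℤ) • (1 : Matrix _ _ ℤ))
    (hsim : γsᵀ * typeForm δ * γs = (ν : ℤ) • typeForm δ) (hM : ν ∣ M)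
    {r' : gspFinAdelic δ} (hr' : r' ∈ principalLevelSubgroup δ 1) :
    Nat.card {c : Fin g ⊕ Fin g → ZMod M |
      (γm.map (Int.castRingHom (ZMod M)) *
        Matrix.of (fun i j => integralAdeleResidue M
          ⟨((r' : GL (Fin g ⊕ Fin g) finAdeleQ) : Matrix (Fin g ⊕ Fin g) (Fin g ⊕ Fin g) finAdeleQ) i j,
            entries_mem_integralAdeles_of_mem_principalLevelSubgroup_one hr' i j⟩)) *ᵥ c = 0} = ν ^ g :=
  natCard_heckeKernel_eq_pow hδ hg hν γm γs hγ hsim hM hr' _ (fun i j _ => by rw [Matrix.of_apply])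

end Literature.AlgebraicGeometry.ModuliOfAbelianVarieties

end
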